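import Mathlib.Data.Rat.Floor
import Mathlib.Algebra.Order.Floor.Ring
import Mathlib.Algebra.Order.Field.Basic
import Mathlib.Algebra.Order.AbsoluteValue.Basic
import Mathlib.Tactic.Linarith
import Mathlib.Tactic.FieldSimp
import Mathlib.Tactic.Positivity
import HarnessLib

/-!
# Round-half-even to an integer (`rneInt`) and to multiples of a positive rational

HONEST FRAMING (venture CertifiedArithmetic / cell `pub-lowprec`): certified error envelopes and
provably optimal rounding/accumulation schemes for low-precision formats under stated cost models;
every table by two implementations; no hardware or vendor claims.

`rneInt r` is the integer nearest to the rational `r`, ties to the even integer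
(IEEE 754 roundTiesToEven restricted to an integer grid). Proved: it is nearest
(`abs_sub_rneInt_le`), within `1/2` (`abs_sub_rneInt_le_half`), even on ties
(`two_dvd_rneInt_of_tie`), fixes integers, is squeezed by integer bounds
(`rneInt_le_of_le`, `le_rneInt_of_le`), and scales to any positive spacing
(`abs_sub_rneInt_mul_le`). This is the arithmetic core of `Format.rneGrid` / `roundNE`
(files `RoundGrid.lean`, `Round.lean`). Everything reduces in the kernel.
-/

namespace Literature.ComputerArithmetic.FloatingPoint

/-! ### Round-half-even to an integer -/

/-- Round-to-nearest, ties-to-even, of a rational to an integer. [cite: IEEE7542019, §4.3.1] -/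
def rneInt (r : ℚ) : ℤ :=
  if r - ⌊r⌋ < 1 / 2 then ⌊r⌋
  else if 1 / 2 < r - ⌊r⌋ then ⌊r⌋ + 1
  else if 2 ∣ ⌊r⌋ then ⌊r⌋ else ⌊r⌋ + 1

/-- `rneInt r` is `⌊r⌋` or `⌊r⌋ + 1`. [folklore] -/
theorem rneInt_eq_floor_or (r : ℚ) : rneInt r = ⌊r⌋ ∨ rneInt r = ⌊r⌋ + 1 := by
  unfold rneInt; split_ifs <;> simp

/-- Integers below `⌊r⌋` are at distance at least `r - ⌊r⌋`. [folklore] -/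
theorem floor_dist_le_abs_sub (r : ℚ) {k : ℤ} (hk : k ≤ ⌊r⌋) : r - ⌊r⌋ ≤ |r - k| := by
  have h1 : (k : ℚ) ≤ ⌊r⌋ := by exact_mod_cast hk
  have h0 : (⌊r⌋ : ℚ) ≤ r := Int.floor_le r
  rw [abs_of_nonneg (by linarith)]
  linarith

/-- Integers above `⌊r⌋` are at distance at least `⌊r⌋ + 1 - r`. [folklore] -/
theorem ceil_dist_le_abs_sub (r : ℚ) {k : ℤ} (hk : ⌊r⌋ + 1 ≤ k) : ⌊r⌋ + 1 - r ≤ |r - k| := by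
  have h1 : ((⌊r⌋ : ℚ) + 1 ≤ k) := by exact_mod_cast hk
  have h0 : r < ⌊r⌋ + 1 := Int.lt_floor_add_one r
  rw [abs_of_nonpos (by linarith)]
  linarith

/-- NEAREST: `rneInt r` is at least as close to `r` as any integer. [cite: IEEE7542019, §4.3.1] -/
theorem abs_sub_rneInt_le (r : ℚ) (k : ℤ) : |r - rneInt r| ≤ |r - k| := by
  have h0 : (⌊r⌋ : ℚ) ≤ r := Int.floor_le r
  have h0' : r < ⌊r⌋ + 1 := Int.lt_floor_add_one r
  rcases le_or_gt k ⌊r⌋ with hk | hk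
  · have hd := floor_dist_le_abs_sub r hk
    unfold rneInt
    split_ifs with h1 h2 h3 <;> push_cast
    · rw [abs_of_nonneg (by linarith)]; linarith
    · rw [abs_of_nonpos (by linarith)]; linarith
    · rw [abs_of_nonneg (by linarith)]; linarith
    · rw [abs_of_nonpos (by linarith)]; linarith
  · have hd := ceil_dist_le_abs_sub r (show ⌊r⌋ + 1 ≤ k by omega)
    unfold rneInt
    split_ifs with h1 h2 h3 <;> push_cast
    · rw [abs_of_nonneg (by linarith)]; linarith
    · rw [abs_of_nonpos (by linarith)]; linarith
    · rw [abs_of_nonneg (by linarith)]; linarith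
    · rw [abs_of_nonpos (by linarith)]; linarith

/-- The rounding error of `rneInt` is at most `1/2`. [folklore] -/
theorem abs_sub_rneInt_le_half (r : ℚ) : |r - rneInt r| ≤ 1 / 2 := by
  have h0 : (⌊r⌋ : ℚ) ≤ r := Int.floor_le r
  have h0' : r < ⌊r⌋ + 1 := Int.lt_floor_add_one r
  unfold rneInt
  split_ifs with h1 h2 <;> push_cast
  · rw [abs_of_nonneg (by linarith)]; linarith
  · rw [abs_of_nonpos (by linarith)]; linarith
  · rw [abs_of_nonneg (by linarith)]; linarith
  · rw [abs_of_nonpos (by linarith)]; linarith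

/-- TIES TO EVEN: if an integer `k ≠ rneInt r` is equally near, then `rneInt r` is even.
[cite: IEEE7542019, §4.3.1] -/
theorem two_dvd_rneInt_of_tie (r : ℚ) {k : ℤ} (heq : |r - k| = |r - rneInt r|)
    (hne : k ≠ rneInt r) : 2 ∣ rneInt r := by
  have h0 : (⌊r⌋ : ℚ) ≤ r := Int.floor_le r
  have h0' : r < ⌊r⌋ + 1 := Int.lt_floor_add_one r
  unfold rneInt at heq hne ⊢
  split_ifs at heq hne ⊢ with h1 h2 h3
  · -- fractional part < 1/2: no other integer is as near
    exfalso
    rcases le_or_gt k ⌊r⌋ with hk | hk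
    · have h1' : (k : ℚ) ≤ ⌊r⌋ := by exact_mod_cast hk
      rw [abs_of_nonneg (by linarith), abs_of_nonneg (by linarith)] at heq
      exact hne (by exact_mod_cast (by linarith : (k : ℚ) = ⌊r⌋))
    · have h1' : ((⌊r⌋ : ℚ) + 1 ≤ k) := by exact_mod_cast (show ⌊r⌋ + 1 ≤ k by omega)
      rw [abs_of_nonpos (by linarith), abs_of_nonneg (by linarith)] at heq
      linarith
  · exfalso
    push_cast at heq
    rcases le_or_gt k ⌊r⌋ with hk | hk
    · have h1' : (k : ℚ) ≤ ⌊r⌋ := by exact_mod_cast hk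
      rw [abs_of_nonneg (by linarith), abs_of_nonpos (by linarith)] at heq
      linarith
    · have h1' : ((⌊r⌋ : ℚ) + 1 ≤ k) := by exact_mod_cast (show ⌊r⌋ + 1 ≤ k by omega)
      rw [abs_of_nonpos (by linarith), abs_of_nonpos (by linarith)] at heq
      exact hne (by exact_mod_cast (by linarith : (k : ℚ) = ⌊r⌋ + 1))
  · exact h3
  · omega

/-- `rneInt` fixes integers. [folklore] -/
@[simp] theorem rneInt_intCast (k : ℤ) : rneInt (k : ℚ) = k := by
  unfold rneInt; simp

/-- `rneInt` of a nonnegative rational is nonnegative. [folklore] -/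
theorem rneInt_nonneg {r : ℚ} (hr : 0 ≤ r) : 0 ≤ rneInt r := by
  have h0' : r < ⌊r⌋ + 1 := Int.lt_floor_add_one r
  have : (0 : ℤ) ≤ ⌊r⌋ + 1 := by
    have : (0 : ℚ) < ⌊r⌋ + 1 := by linarith
    exact_mod_cast this.le
  have hf : 0 ≤ ⌊r⌋ ∨ ⌊r⌋ = -1 := by omega
  rcases rneInt_eq_floor_or r with h | h <;> rw [h]
  · rcases hf with hf | hf
    · exact hf
    · -- ⌊r⌋ = -1 and 0 ≤ r is impossible
      exfalso
      have : ((⌊r⌋ : ℤ) : ℚ) = -1 := by exact_mod_cast hf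
      have h5 : (0 : ℤ) ≤ ⌊r⌋ := Int.floor_nonneg.mpr hr
      omega
  · exact this

/-- Upper monotonicity against integers: `r ≤ k` implies `rneInt r ≤ k`. [folklore] -/
theorem rneInt_le_of_le {r : ℚ} {k : ℤ} (h : r ≤ k) : rneInt r ≤ k := by
  have h0 : (⌊r⌋ : ℚ) ≤ r := Int.floor_le r
  have hfk : ⌊r⌋ ≤ k := Int.floor_le_iff.mpr (by linarith)
  rcases lt_or_eq_of_le hfk with hlt | heq
  · rcases rneInt_eq_floor_or r with h' | h' <;> rw [h'] <;> omega
  · -- r = k exactly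
    have : r = k := le_antisymm h (by rw [← heq]; exact h0)
    rw [this, rneInt_intCast]

/-- Lower monotonicity against integers: `k ≤ r` implies `k ≤ rneInt r`. [folklore] -/
theorem le_rneInt_of_le {r : ℚ} {k : ℤ} (h : (k : ℚ) ≤ r) : k ≤ rneInt r := by
  have hfk : k ≤ ⌊r⌋ := Int.le_floor.mpr h
  rcases rneInt_eq_floor_or r with h' | h' <;> rw [h'] <;> omega

/-- Scaling: the nearest multiple of a positive `c` is `rneInt (r / c) · c`. [folklore] -/
theorem abs_sub_rneInt_mul_le (r : ℚ) {c : ℚ} (hc : 0 < c) (k : ℤ) :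
    |r - rneInt (r / c) * c| ≤ |r - k * c| := by
  have h := abs_sub_rneInt_le (r / c) k
  have e1 : r - rneInt (r / c) * c = (r / c - rneInt (r / c)) * c := by field_simp
  have e2 : r - k * c = (r / c - k) * c := by field_simp
  rw [e1, e2, abs_mul, abs_mul, abs_of_pos hc]
  exact mul_le_mul_of_nonneg_right h hc.le

end Literature.ComputerArithmetic.FloatingPoint
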